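import Literature.AlgebraicTopology.SingularHomology.CollapseSimplexBridge
import HarnessLib

/-!
# The two cube–simplex devices are non-antipodal in every dimension

Topic `Literature/AlgebraicTopology/SingularHomology`. Companion to `CollapseSimplexBridge.lean`,
which compares the two maps of pairs `(Iⁿ, ∂Iⁿ) → (Δⁿ, ∂Δⁿ)` through which the tree reads a
singular simplex `g : (Δⁿ, ∂Δⁿ) → (X, x₀)` as an element of `πₙ(X, x₀)` — the radial homeomorphism
`κ_h = cubeSimplexHomeo n` and the collapse `κ_c = CubeCollapse.collapse` (Spanier's "arbitrary
homeomorphism `(Δⁿ, Δ̇ⁿ) ≈ (Iⁿ, İⁿ)`", *Algebraic Topology* (1981), Ch. 7 §4 p. 391) — and proves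
`collapseClass g hg = simplexClass g hg` under the predicate `NonAntipodal n` (for no `y ∈ ∂Iⁿ` are
`toBall (κ_h y) = 2y - 1` and `w(y) = toBall (κ_c y)` opposite unit vectors), established there in
dimension `2` (`nonAntipodal_two`) and in every dimension `N ≥ 2` (`nonAntipodal_of_two_le`).

This file settles the two remaining dimensions and records the universal closure:

* `nonAntipodal_zero` — `∂I⁰ = ∅`, vacuous;
* `nonAntipodal_one` — the single antipodality equation `P₁ - P₂ - c + λ(2y₀ - 1) = 0` of
  `antipodal_eq` reads `(y₀ - 1/2)(1 + 2λ) = 0` (`P₁ = y₀`, `P₂ = 0`, `c = 1/2`), impossible for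
  `y₀ ∈ {0, 1}` (`chart_collapse_add_smul_ne_zero_one`, after the gauge reduction
  `nonAntipodal_of_chart_add_smul_ne_zero`: `w(y) = μ • chart (κ_c y)` with `μ > 0`);
* `nonAntipodal n : NonAntipodal n` for every `n`, and `NonAntipodal_holds : ∀ n, NonAntipodal n` —
  `NonAntipodal` is a predicate `ℕ → Prop` whose dimension parameter enters through
  `variable (n) in`, so the closed statement it stands for is this universal closure;
* `collapseClass_eq_simplexClass'` — `[g ∘ κ_c] = [g ∘ κ_h]` in `πₙ(X, x₀)` with no dimension
  hypothesis.

Everything is elementary and proved; `[folklore]` (a computation about this tree's two explicit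
devices; no published source states it).

## References

* E. H. Spanier, *Algebraic Topology*, Springer (1981), Ch. 7 §4, p. 391. [Spanier1981]
* A. Hatcher, *Algebraic Topology*, CUP (2002), §4.1, p. 340 (maps of pairs `(Iⁿ, ∂Iⁿ)`).
  [HatcherAT2002]
-/

noncomputable section

open Set Metric Function
open scoped unitInterval

universe u

namespace Literature.AlgebraicTopology.SingularHomology

open CubeCollapse
open Literature.AlgebraicTopology.Homotopy (SimplexBall.chart SimplexBall.c SimplexBall.body)

variable {N : ℕ}

/-- **The gauge reduction**: non-antipodality in dimension `N` follows once the centred chart of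
`κ_c(y)` is never a negative multiple of `2y - 1` on `∂Iᴺ` (`w(y) = μ • chart (κ_c y)` with
`μ > 0`, because `‖2y - 1‖ = 1` there). [folklore] -/
theorem nonAntipodal_of_chart_add_smul_ne_zero
    (h : ∀ y ∈ Cube.boundary (Fin N), ∀ lam : ℝ, 0 < lam →
      SimplexBall.chart N (collapse y) + lam • cubeStretch N y ≠ 0) :
    NonAntipodal N := by
  intro y hy h0
  set x := SimplexBall.chart N (collapse y) with hx
  set μ : ℝ := gauge (SimplexBall.body N) x / gauge (closedBall (0 : Fin N → ℝ) 1) x with hμ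
  have hw : collapseBall y = μ • x := rfl
  have hμ0 : 0 ≤ μ := div_nonneg (gauge_nonneg _) (gauge_nonneg _)
  have hv : ‖cubeStretch N y‖ = 1 := (norm_cubeStretch_eq_one_iff y).2 hy
  have hμne : μ ≠ 0 := by
    intro h1
    rw [hw, h1, zero_smul, zero_add] at h0
    rw [h0, norm_zero] at hv
    exact zero_ne_one hv
  have hμpos : 0 < μ := lt_of_le_of_ne hμ0 (Ne.symm hμne)
  refine h y hy μ⁻¹ (inv_pos.2 hμpos) ?_
  have := congrArg (fun v => μ⁻¹ • v) h0
  simpa only [hw, smul_add, smul_smul, inv_mul_cancel₀ hμne, one_smul, smul_zero] using this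

/-- **Dimension `0`**: `∂I⁰ = ∅`, so the two devices are (vacuously) non-antipodal. [folklore] -/
theorem nonAntipodal_zero : NonAntipodal 0 := by
  rintro y ⟨i, -⟩
  exact i.elim0

/-- **The algebraic core in dimension `1`**: the centred chart `y₀ - 1/2` of `κ₁(y) = (1 - y₀, y₀)`
is never a negative multiple of `2y₀ - 1` for `y₀ ∈ {0, 1}`. [folklore] -/
lemma chart_collapse_add_smul_ne_zero_one {y : Fin 1 → I} (hy : y ∈ Cube.boundary (Fin 1))
    {lam : ℝ} (hlam : 0 < lam) : SimplexBall.chart 1 (collapse y) + lam • cubeStretch 1 y ≠ 0 := by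
  intro h
  have E := antipodal_eq h Nat.one_pos
  rw [pp_of_lt y (by norm_num : 1 < 0 + 1 + 1), pp_succ y Nat.one_pos, pp_zero, one_mul,
    sub_zero] at E
  have hc : SimplexBall.c 1 = 1 / 2 := by rw [SimplexBall.c]; norm_num
  rw [hc] at E
  obtain ⟨l, hl⟩ := hy
  have hl0 : l = 0 := Fin.fin_one_eq_zero l
  subst hl0
  have ht : tval y 0 = 0 ∨ tval y 0 = 1 := by
    rcases hl with h0 | h1
    · left; rw [tval_of_lt y Nat.one_pos]; exact_mod_cast congrArg Subtype.val h0
    · right; rw [tval_of_lt y Nat.one_pos]; exact_mod_cast congrArg Subtype.val h1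
  rcases ht with h0 | h1
  · rw [h0] at E; linarith
  · rw [h1] at E; linarith

/-- **Dimension `1`**: the two devices are non-antipodal (`κ₁(y) = (1 - y₀, y₀)` and `2y₀ - 1`
point the same way at `y₀ ∈ {0, 1}`). [folklore] -/
theorem nonAntipodal_one : NonAntipodal 1 :=
  nonAntipodal_of_chart_add_smul_ne_zero fun _ hy _ hlam =>
    chart_collapse_add_smul_ne_zero_one hy hlam

/-- **The two devices are non-antipodal in every dimension** (`0`: vacuous; `1`:
`nonAntipodal_one`; `≥ 2`: `nonAntipodal_of_two_le`). [folklore] -/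
theorem nonAntipodal (n : ℕ) : NonAntipodal n := by
  rcases n with _ | _ | n
  · exact nonAntipodal_zero
  · exact nonAntipodal_one
  · exact nonAntipodal_of_two_le (by omega)

/-- **Discharge of `NonAntipodal`.** `NonAntipodal` is a predicate `ℕ → Prop` (its dimension
parameter enters through `variable (n) in`); the closed statement it stands for is its universal
closure `∀ n, NonAntipodal n`, proved here: the radial device `κ_h` and the collapse `κ_c` are
non-antipodal on `∂Iⁿ` in every dimension `n`. [folklore] -/
theorem NonAntipodal_holds : ∀ n : ℕ, NonAntipodal n := nonAntipodal

/-- **`[g ∘ κ_c] = [g ∘ κ_h]` in `πₙ(X, x₀)` in every dimension `n`** — the dimension hypothesis of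
`collapseClass_eq_simplexClass_of_two_le` removed. [folklore] -/
theorem collapseClass_eq_simplexClass' {X : Type u} [TopologicalSpace X] {x₀ : X}
    (g : C(StdSimplex N, X)) (hg : ∀ t ∈ stdBoundary N, g t = x₀) :
    collapseClass g hg = simplexClass g hg :=
  collapseClass_eq_simplexClass (nonAntipodal N) g hg

end Literature.AlgebraicTopology.SingularHomology

end
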